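import Mathlib
import Literature.Combinatorics.Optimization.FractionalLpFormulations
import HarnessLib

/-!
# Reductions between fractional optimization problems (Braun–Pokutta–Roy 2016, §4.1)

G. Braun, S. Pokutta, A. Roy, *Strong reductions for extended formulations* [BraunPokuttaRoy2016], §4.1 "Reduction
between fractional problems" (arXiv:1512.04932v3 numbering): **Def. 4.5** (reduction: maps `*` on instances and solutions
and four nonnegative matrices `M₁^{(n)}, M₁^{(d)}, M₂^{(n)}, M₂^{(d)}` with (4.1-complete), (4.1-denominator), (4.1-sound))
and **Thm. 4.6**: `fc(𝒫₁,C₁,S₁) ≤ rk_LP[M₂^{(n)};M₂^{(d)}] + rk_LP[M₁^{(n)};M₁^{(d)}] + rk_+[M₁^{(n)};M₁^{(d)}]·fc(𝒫₂,C₂,S₂)`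
and the same with `fc_SDP`, `rk_SDP`, `rk_psd` ("Reductions for fractional optimization problems are completely analogous
to the non-fractional case … the reduction theorem is a special case of Theorem 2.22"; "the trivial choice `M₁^{(d)} = 0`
and `M₂^{(d)} = val^d` …").

TYPED AND PROVED here for two maximization problems (`τ₁ = τ₂ = +1`), in the matrix currency of
`FractionalLpFormulations.lean` (no named facts): `FracMaxProblem.Reduction P₁ P₂` (Def. 4.5 verbatim), the stacked
matrices `N₁ = [M₁^{(n)}; M₁^{(d)}]`, `N₂ = [M₂^{(n)}; M₂^{(d)}]` on the sound rows, `slackMatrix_eq`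
(`M_{𝒫₁} = M_{𝒫₂}∘* ⊙ N₁ + N₂` blockwise — this is (4.1-complete) + (4.1-denominator)), **Thm. 4.6 LP clause**
`hasNonnegFactorization_slackMatrix` (`nnr(M_{𝒫₁}) ≤ nnr(M_{𝒫₂})·nnr(N₁) + nnr(N₂)`, by the submatrix/Hadamard/sum rules
of `LpFormulationReductions.lean`), its affine case `…_affine` (`+1`), the formulation-level forms
`nonempty_fracLPFormulation` / `isEmpty_fracLPFormulation_affine` (through Thm. 4.4 of `FractionalLpFormulations.lean`),
**Thm. 4.6 SDP clause** in psd-rank currency `hasPsdFactorization_slackMatrix` (+ `_affine`), and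
`MaxProblem.Reduction.toFrac` (a Def. 3.1 reduction is a Def. 4.5 reduction of the `val^d = 1` problems with
`M₁^{(d)} = 0`, `M₂^{(d)} = 1`).  The printed sizes carry `rk_LP`/`rk_SDP` of the auxiliary matrices; in the tree's
currency without free affine term these are the `nnr`/`rk_psd` bounds above (cf. Remark 2.19, `SdpFormulationReductions.lean`).
-/

noncomputable section

open Finset Matrix

namespace Literature.Combinatorics.Optimization

variable {σ₁ φ₁ σ₂ φ₂ : Type*}

/-- **Def. 4.5 (reduction between fractional problems, both maximization: `τ₁ = τ₂ = +1`)**: maps `*` on instances and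
on feasible solutions and four nonnegative `𝔍₁ × 𝒮₁` matrices `M₁^{(n)}, M₁^{(d)}, M₂^{(n)}, M₂^{(d)}` with
(4.1-complete) `C₁(𝔍₁) val^d_{𝔍₁}(s₁) − val^n_{𝔍₁}(s₁) = [C₂(𝔍₁*) val^d_{𝔍₁*}(s₁*) − val^n_{𝔍₁*}(s₁*)]·M₁^{(n)}(𝔍₁,s₁) + M₂^{(n)}(𝔍₁,s₁)`,
(4.1-denominator) `val^d_{𝔍₁}(s₁) = val^d_{𝔍₁*}(s₁*)·M₁^{(d)}(𝔍₁,s₁) + M₂^{(d)}(𝔍₁,s₁)`,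
(4.1-sound) `OPT(𝔍₁*) ≤ S₂(𝔍₁*)` if `OPT(𝔍₁) ≤ S₁(𝔍₁)`. [cite: BraunPokuttaRoy2016, Def. 4.5 (arXiv v3)] -/
structure FracMaxProblem.Reduction (P₁ : FracMaxProblem σ₁ φ₁) (P₂ : FracMaxProblem σ₂ φ₂) where
  /-- `* : 𝔍₁ → 𝔍₂` -/
  inst : φ₁ → φ₂
  /-- `* : 𝒮₁ → 𝒮₂` -/
  sol : σ₁ → σ₂
  /-- `M₁^{(n)}` -/
  M₁n : φ₁ → σ₁ → ℝ
  /-- `M₁^{(d)}` -/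
  M₁d : φ₁ → σ₁ → ℝ
  /-- `M₂^{(n)}` -/
  M₂n : φ₁ → σ₁ → ℝ
  /-- `M₂^{(d)}` -/
  M₂d : φ₁ → σ₁ → ℝ
  M₁n_nonneg : ∀ f s, 0 ≤ M₁n f s
  M₁d_nonneg : ∀ f s, 0 ≤ M₁d f s
  M₂n_nonneg : ∀ f s, 0 ≤ M₂n f s
  M₂d_nonneg : ∀ f s, 0 ≤ M₂d f s
  /-- (4.1-complete) -/
  complete : ∀ f s, P₁.C f * P₁.vald f s - P₁.valn f s =
    (P₂.C (inst f) * P₂.vald (inst f) (sol s) - P₂.valn (inst f) (sol s)) * M₁n f s + M₂n f s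
  /-- (4.1-denominator) -/
  denominator : ∀ f s, P₁.vald f s = P₂.vald (inst f) (sol s) * M₁d f s + M₂d f s
  /-- (4.1-sound) -/
  sound : ∀ f, P₁.Sound f → P₂.Sound (inst f)

namespace FracMaxProblem.Reduction

variable {P₁ : FracMaxProblem σ₁ φ₁} {P₂ : FracMaxProblem σ₂ φ₂}

/-- `*` on sound instances. [cite: BraunPokuttaRoy2016, Def. 4.5 (4.1-sound) (arXiv v3)] -/
def instSound (R : P₁.Reduction P₂) (f : {f : φ₁ // P₁.Sound f}) : {g : φ₂ // P₂.Sound g} :=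
  ⟨R.inst f.1, R.sound f.1 f.2⟩

/-- The stacked matrix `[M₁^{(n)}; M₁^{(d)}]` on the sound rows (tag `true` = numerator block, as for the slack matrix).
[cite: BraunPokuttaRoy2016, Thm. 4.6 (arXiv v3)] -/
def N₁ (R : P₁.Reduction P₂) : Bool × {f : φ₁ // P₁.Sound f} → σ₁ → ℝ
  | (false, f), s => R.M₁d f.1 s
  | (true, f), s => R.M₁n f.1 s

/-- The stacked matrix `[M₂^{(n)}; M₂^{(d)}]` on the sound rows. [cite: BraunPokuttaRoy2016, Thm. 4.6 (arXiv v3)] -/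
def N₂ (R : P₁.Reduction P₂) : Bool × {f : φ₁ // P₁.Sound f} → σ₁ → ℝ
  | (false, f), s => R.M₂d f.1 s
  | (true, f), s => R.M₂n f.1 s

/-- `N₁ ≥ 0`. [cite: BraunPokuttaRoy2016, Def. 4.5 (arXiv v3)] -/
theorem N₁_nonneg (R : P₁.Reduction P₂) (p : Bool × {f : φ₁ // P₁.Sound f}) (s : σ₁) : 0 ≤ R.N₁ p s := by
  rcases p with ⟨_ | _, f⟩
  · exact R.M₁d_nonneg _ _
  · exact R.M₁n_nonneg _ _

/-- `N₂ ≥ 0`. [cite: BraunPokuttaRoy2016, Def. 4.5 (arXiv v3)] -/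
theorem N₂_nonneg (R : P₁.Reduction P₂) (p : Bool × {f : φ₁ // P₁.Sound f}) (s : σ₁) : 0 ≤ R.N₂ p s := by
  rcases p with ⟨_ | _, f⟩
  · exact R.M₂d_nonneg _ _
  · exact R.M₂n_nonneg _ _

/-- The two identities of Def. 4.5 say: `M_{𝒫₁} = (M_{𝒫₂} pulled back along `*`) ∘ N₁ + N₂` blockwise.
[cite: BraunPokuttaRoy2016, Def. 4.5 / proof of Thm. 4.6 (arXiv v3)] -/
theorem slackMatrix_eq (R : P₁.Reduction P₂) :
    P₁.slackMatrix = fun p s => P₂.slackMatrix (p.1, R.instSound p.2) (R.sol s) * R.N₁ p s + R.N₂ p s := by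
  funext p s
  rcases p with ⟨_ | _, f⟩
  · exact R.denominator f.1 s
  · exact R.complete f.1 s

/-- **Thm. 4.6, LP clause, in nonnegative-rank currency:** nonnegative factorizations of `M_{𝒫₂,C₂,S₂}` (size `r`), of
`[M₁^{(n)}; M₁^{(d)}]` (size `r₁`) and of `[M₂^{(n)}; M₂^{(d)}]` (size `r₂`, sound rows) give one of `M_{𝒫₁,C₁,S₁}` of size
`r·r₁ + r₂` ("`fc(𝒫₁) ≤ rk_LP[M₂] + rk_LP[M₁] + rk_+[M₁]·fc(𝒫₂)`", via Thm. 4.4).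
[cite: BraunPokuttaRoy2016, Thm. 4.6 (arXiv v3)] -/
theorem hasNonnegFactorization_slackMatrix (R : P₁.Reduction P₂) {r r₁ r₂ : ℕ}
    (h₂ : HasNonnegFactorization P₂.slackMatrix r) (h₁ : HasNonnegFactorization R.N₁ r₁)
    (hM₂ : HasNonnegFactorization R.N₂ r₂) : HasNonnegFactorization P₁.slackMatrix (r * r₁ + r₂) := by
  rw [R.slackMatrix_eq]
  exact ((h₂.submatrix (fun p : Bool × {f : φ₁ // P₁.Sound f} => (p.1, R.instSound p.2)) R.sol).hadamard h₁).add hM₂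

/-- **Thm. 4.6 for affine reductions** (all four matrices constant along rows — "the trivial choice `M₁^{(d)} = 0`" is
allowed): `nnr(M_{𝒫₁}) ≤ nnr(M_{𝒫₂}) + 1`. [cite: BraunPokuttaRoy2016, Thm. 4.6 (arXiv v3)] -/
theorem hasNonnegFactorization_slackMatrix_affine (R : P₁.Reduction P₂) (ln ld mn md : φ₁ → ℝ)
    (h₁n : ∀ f s, R.M₁n f s = ln f) (h₁d : ∀ f s, R.M₁d f s = ld f) (h₂n : ∀ f s, R.M₂n f s = mn f)
    (h₂d : ∀ f s, R.M₂d f s = md f) {r : ℕ} (h₂ : HasNonnegFactorization P₂.slackMatrix r) :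
    HasNonnegFactorization P₁.slackMatrix (r + 1) := by
  have h₁ : HasNonnegFactorization R.N₁ 1 :=
    hasNonnegFactorization_of_rowConst (fun p : Bool × {f : φ₁ // P₁.Sound f} => if p.1 then ln p.2.1 else ld p.2.1)
      (fun p s => by rcases p with ⟨_ | _, f⟩ <;> simp [N₁, h₁n, h₁d]) R.N₁_nonneg
  have hμ : HasNonnegFactorization R.N₂ 1 :=
    hasNonnegFactorization_of_rowConst (fun p : Bool × {f : φ₁ // P₁.Sound f} => if p.1 then mn p.2.1 else md p.2.1)
      (fun p s => by rcases p with ⟨_ | _, f⟩ <;> simp [N₂, h₂n, h₂d]) R.N₂_nonneg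
  simpa using R.hasNonnegFactorization_slackMatrix h₂ h₁ hμ

/-- **Thm. 4.6 at formulation level (LP):** an LP formulation of `𝒫₂` of size `R₂` and nonnegative factorizations of the
stacked `M₁`, `M₂` (sizes `r₁`, `r₂`) give an LP formulation of `𝒫₁` of size `(R₂+1)·r₁ + r₂` (Thm. 4.4 both ways).
[cite: BraunPokuttaRoy2016, Thm. 4.6 (arXiv v3)] -/
theorem nonempty_fracLPFormulation (R : P₁.Reduction P₂) {R₂ r₁ r₂ : ℕ} (E : FracLPFormulation P₂ R₂)
    (h₁ : HasNonnegFactorization R.N₁ r₁) (hM₂ : HasNonnegFactorization R.N₂ r₂) :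
    Nonempty (FracLPFormulation P₁ ((R₂ + 1) * r₁ + r₂)) :=
  FracLPFormulation.nonempty_of_hasNonnegFactorization
    (R.hasNonnegFactorization_slackMatrix E.hasNonnegFactorization_slackMatrix h₁ hM₂)

/-- **How lower bounds travel (LP, affine case):** if `M_{𝒫₁,C₁,S₁}` has no nonnegative factorization of size `R₂ + 2`,
then `𝒫₂` has no `(C₂,S₂)`-approximate LP formulation of size `R₂`. [cite: BraunPokuttaRoy2016, Thm. 4.6 (arXiv v3)] -/
theorem isEmpty_fracLPFormulation_affine (R : P₁.Reduction P₂) (ln ld mn md : φ₁ → ℝ)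
    (h₁n : ∀ f s, R.M₁n f s = ln f) (h₁d : ∀ f s, R.M₁d f s = ld f) (h₂n : ∀ f s, R.M₂n f s = mn f)
    (h₂d : ∀ f s, R.M₂d f s = md f) {R₂ : ℕ} (hno : ¬ HasNonnegFactorization P₁.slackMatrix (R₂ + 2)) :
    IsEmpty (FracLPFormulation P₂ R₂) :=
  ⟨fun E => hno (R.hasNonnegFactorization_slackMatrix_affine ln ld mn md h₁n h₁d h₂n h₂d
    E.hasNonnegFactorization_slackMatrix)⟩

/-- **Thm. 4.6, SDP clause, in psd-rank currency:** psd factorizations of `M_{𝒫₂}` (size `r`), of `[M₁^{(n)}; M₁^{(d)}]`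
(size `r₁`) and of `[M₂^{(n)}; M₂^{(d)}]` (size `r₂`) give one of `M_{𝒫₁}` of size `r·r₁ + r₂`.
[cite: BraunPokuttaRoy2016, Thm. 4.6 (arXiv v3)] -/
theorem hasPsdFactorization_slackMatrix (R : P₁.Reduction P₂) {r r₁ r₂ : ℕ}
    (h₂ : HasPsdFactorization P₂.slackMatrix r) (h₁ : HasPsdFactorization R.N₁ r₁)
    (hM₂ : HasPsdFactorization R.N₂ r₂) : HasPsdFactorization P₁.slackMatrix (r * r₁ + r₂) := by
  rw [R.slackMatrix_eq]
  exact ((h₂.submatrix (fun p : Bool × {f : φ₁ // P₁.Sound f} => (p.1, R.instSound p.2)) R.sol).hadamard h₁).add hM₂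

/-- **Thm. 4.6, SDP clause, affine reductions:** `rk_psd(M_{𝒫₁}) ≤ rk_psd(M_{𝒫₂}) + 1`.
[cite: BraunPokuttaRoy2016, Thm. 4.6 (arXiv v3)] -/
theorem hasPsdFactorization_slackMatrix_affine (R : P₁.Reduction P₂) (ln ld mn md : φ₁ → ℝ)
    (h₁n : ∀ f s, R.M₁n f s = ln f) (h₁d : ∀ f s, R.M₁d f s = ld f) (h₂n : ∀ f s, R.M₂n f s = mn f)
    (h₂d : ∀ f s, R.M₂d f s = md f) {r : ℕ} (h₂ : HasPsdFactorization P₂.slackMatrix r) :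
    HasPsdFactorization P₁.slackMatrix (r + 1) := by
  have h₁ : HasPsdFactorization R.N₁ 1 :=
    MaxProblem.Reduction.hasPsdFactorization_of_rowConst (fun p : Bool × {f : φ₁ // P₁.Sound f} => if p.1 then ln p.2.1 else ld p.2.1)
      (fun p s => by rcases p with ⟨_ | _, f⟩ <;> simp [N₁, h₁n, h₁d]) R.N₁_nonneg
  have hμ : HasPsdFactorization R.N₂ 1 :=
    MaxProblem.Reduction.hasPsdFactorization_of_rowConst (fun p : Bool × {f : φ₁ // P₁.Sound f} => if p.1 then mn p.2.1 else md p.2.1)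
      (fun p s => by rcases p with ⟨_ | _, f⟩ <;> simp [N₂, h₂n, h₂d]) R.N₂_nonneg
  simpa using R.hasPsdFactorization_slackMatrix h₂ h₁ hμ

end FracMaxProblem.Reduction

/-- A reduction between optimization problems (Def. 3.1) is a reduction between the associated fractional problems with
`val^d = 1`, with the trivial denominator data `M₁^{(d)} = 0`, `M₂^{(d)} = 1`.
[cite: BraunPokuttaRoy2016, §4.1 ("completely analogous to the non-fractional case") (arXiv v3)] -/
def MaxProblem.Reduction.toFrac {P₁ : MaxProblem σ₁ φ₁} {P₂ : MaxProblem σ₂ φ₂} (R : P₁.Reduction P₂) :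
    P₁.toFrac.Reduction P₂.toFrac where
  inst := R.inst
  sol := R.sol
  M₁n := R.M₁
  M₁d _ _ := 0
  M₂n := R.M₂
  M₂d _ _ := 1
  M₁n_nonneg := R.M₁_nonneg
  M₁d_nonneg _ _ := le_rfl
  M₂n_nonneg := R.M₂_nonneg
  M₂d_nonneg _ _ := zero_le_one
  complete f s := by simpa [MaxProblem.toFrac] using R.complete f s
  denominator f s := by simp [MaxProblem.toFrac]
  sound f hf := (MaxProblem.toFrac_sound P₂ _).2 (R.sound f ((MaxProblem.toFrac_sound P₁ f).1 hf))

end Literature.Combinatorics.Optimization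

end
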